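import Literature.Computability.Cryptography.LWEPrimePowerRounding
import Literature.Computability.Complexity.GF2KernelProgram
import Literature.Computability.Complexity.HadamardPCP
import HarnessLib

/-!
# Solving a full-column-rank linear system over `GF(2)` by kernel tests (MP12 Thm. 3.1, the machine's Gaussian elimination, I)

Topic `Computability/Cryptography` (LWE), grouping namespace `LWE.MP12`; bridge between
`LWEPrimePowerRounding.lean` (`FullRank`, full column rank of a matrix over `𝔽_p`) and
`Complexity/GF2KernelProgram.lean` (`GF2Kernel.progK`, the polynomial-time kernel TEST over `GF(2)`
with `progK_eq_true_iff`/`hasKernel_ofFn_iff`). Proved material (no named fact) towards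
`Literature.Computability.Cryptography.blprs_gapSVP_sqrt_dim_to_lwe_classical` (**pqc.S21**),
component Thm. 2.17 = Micciancio–Peikert 2012, Thm. 3.1 ("solve for `s` by Gaussian elimination"),
the top-digit step of the machine for `p = 2`.

A linear system `A x = b` over `GF(2)` whose matrix has FULL COLUMN RANK has at most one solution, and
its bits can be read off `d` kernel tests: `xⱼ = 1` iff the matrix `[A | b]` with the extra row
`[eⱼ | 1]` has a nonzero kernel vector (the kernel vectors of `[A | b]` are `(x, 1)` for solutions
`x`, full rank killing `(y, 0)`). So the tree's kernel test `progK` SOLVES such systems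
(`gf2Solve`), in polynomial time on codes (`GF2Kernel.progKCode`, used by the sequel).

* `sum_toZ_mul_toZ` — with `BLR.toZ` of `HadamardPCP.lean` (bits as elements of `ZMod 2`), the dot
  product over `GF(2)` is the parity of the overlap.
* `augRows`, `gf2SolveBit`, `gf2Solve`; **`gf2Solve_eq`**: if the bit matrix has full column rank
  (as a `ZMod 2` matrix, `FullRank`) and `x` solves `A x = b`, then `gf2Solve A b = x`.

## References

* D. Micciancio, C. Peikert, *Trapdoors for lattices: simpler, tighter, faster, smaller*, EUROCRYPT 2012,
  LNCS 7237; full version IACR ePrint 2011/501, §3, proof of Thm. 3.1, p. 16. [MicciancioPeikert2012]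
* D. E. Knuth, *The Art of Computer Programming*, Vol. 2, 3rd ed., 1998, §4.6.2, Algorithm N.
  [KnuthTAOCP2]
-/

namespace Literature.Computability.Cryptography

namespace LWE

namespace MP12

open Finset Literature.Computability.Complexity Literature.Computability.Complexity.GF2Kernel
  Literature.Computability.Complexity.BLR

/-! ### Bits as elements of `ZMod 2` -/

section Bits

/-- `toZ b = 0 ↔ b = false` (`BLR.toZ` of `HadamardPCP.lean`: a bit as an element of `ZMod 2`). [folklore] -/
theorem toZ_eq_zero_iff (b : Bool) : toZ b = 0 ↔ b = false := by
  cases b <;> decide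

variable {d : ℕ}

/-- **The dot product over `GF(2)` is the parity of the overlap.** [folklore] -/
theorem sum_toZ_mul_toZ (u v : Fin d → Bool) :
    ∑ i, toZ (u i) * toZ (v i) = ((univ.filter fun i => u i && v i).card : ZMod 2) := by
  rw [Finset.card_filter, Nat.cast_sum]
  refine Finset.sum_congr rfl fun i _ => ?_
  rw [← toZ_and]
  cases (u i && v i) <;> simp [BLR.toZ]

/-- The dot product over `GF(2)` vanishes iff the overlap is even. [folklore] -/
theorem sum_toZ_mul_toZ_eq_zero_iff (u v : Fin d → Bool) :
    ∑ i, toZ (u i) * toZ (v i) = 0 ↔ Even (univ.filter fun i => u i && v i).card := by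
  rw [sum_toZ_mul_toZ, ZMod.natCast_eq_zero_iff_even]

end Bits

/-! ### The solver -/

section Solve

variable {m' d : ℕ}

/-- The augmented rows `[A | b]` with the pin row `[eⱼ | 1]` appended, as bit vectors of length `d + 1`
indexed by `Fin (m' + 1)`. [folklore] -/
def augRows (A : Fin m' → Fin d → Bool) (b : Fin m' → Bool) (j : Fin d) : Fin (m' + 1) → Fin (d + 1) → Bool :=
  Fin.snoc (fun i => Fin.snoc (A i) (b i)) (Fin.snoc (fun c => decide (c = j)) true)

/-- **Bit `j` of the solution**: does `[A | b ; eⱼ | 1]` have a nonzero kernel vector? (the tree's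
polynomial-time kernel test `progK`). [cite: KnuthTAOCP2, §4.6.2, Algorithm N] -/
def gf2SolveBit (A : Fin m' → Fin d → Bool) (b : Fin m' → Bool) (j : Fin d) : Bool :=
  progK (List.ofFn fun i => List.ofFn (augRows A b j i))

/-- **The solver**: the `d` bits. [cite: MicciancioPeikert2012, Thm. 3.1 proof (p. 16: "solve for `s` by Gaussian elimination")] -/
def gf2Solve (A : Fin m' → Fin d → Bool) (b : Fin m' → Bool) : Fin d → Bool := fun j => gf2SolveBit A b j

/-- The bit matrix as a matrix over `ZMod 2`. [folklore] -/
def matZ (A : Fin m' → Fin d → Bool) : Fin m' → Fin d → ZMod 2 := fun i c => toZ (A i c)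

/-- `x` solves `A x = b` over `GF(2)`. [folklore] -/
def Solves (A : Fin m' → Fin d → Bool) (b : Fin m' → Bool) (x : Fin d → Bool) : Prop :=
  ∀ i, ∑ c, toZ (A i c) * toZ (x c) = toZ (b i)

/-- Under full column rank a homogeneous solution is zero. [folklore] -/
theorem eq_false_of_fullRank {A : Fin m' → Fin d → Bool} (hA : FullRank (matZ A)) {y : Fin d → Bool}
    (hy : ∀ i, ∑ c, toZ (A i c) * toZ (y c) = 0) : y = fun _ => false := by
  have h := hA (fun c => toZ (y c)) fun i => by
    simpa [dotProduct, matZ] using hy i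
  funext c
  exact (toZ_eq_zero_iff _).1 (congrFun h c)

/-- Under full column rank the solution is unique. [folklore] -/
theorem solves_unique {A : Fin m' → Fin d → Bool} (hA : FullRank (matZ A)) {b : Fin m' → Bool}
    {x x' : Fin d → Bool} (hx : Solves A b x) (hx' : Solves A b x') : x = x' := by
  have hy : (fun c => xor (x c) (x' c)) = fun _ => false := by
    refine eq_false_of_fullRank hA fun i => ?_
    simp_rw [toZ_xor, mul_add, Finset.sum_add_distrib, hx i, hx' i]
    exact CharTwo.add_self_eq_zero _
  funext c
  have := congrFun hy c
  cases hxc : x c <;> cases hxc' : x' c <;> simp_all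

/-- Overlap parity of a `snoc`-ed pair of vectors: the last coordinates contribute one term. [folklore] -/
theorem sum_snoc_toZ (u : Fin d → Bool) (a : Bool) (v : Fin d → Bool) (b : Bool) :
    ∑ i : Fin (d + 1), toZ ((Fin.snoc u a : Fin (d + 1) → Bool) i) * toZ ((Fin.snoc v b : Fin (d + 1) → Bool) i) =
      ∑ i, toZ (u i) * toZ (v i) + toZ a * toZ b := by
  rw [Fin.sum_univ_castSucc]
  simp only [Fin.snoc_castSucc, Fin.snoc_last]

/-- The pin row picks coordinate `j`. [folklore] -/
theorem sum_toZ_pin (x : Fin d → Bool) (j : Fin d) : ∑ c, toZ (decide (c = j)) * toZ (x c) = toZ (x j) := by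
  rw [Finset.sum_eq_single j]
  · simp [BLR.toZ]
  · intro c _ hc
    simp [hc, BLR.toZ]
  · simp

/-- **The kernel test reads bit `j` of the solution**: under full column rank, if `x` solves `A x = b`
then `[A | b ; eⱼ | 1]` has a nonzero kernel vector iff `xⱼ = 1`. [cite: KnuthTAOCP2, §4.6.2] -/
theorem gf2SolveBit_eq {A : Fin m' → Fin d → Bool} (hA : FullRank (matZ A)) {b : Fin m' → Bool}
    {x : Fin d → Bool} (hx : Solves A b x) (j : Fin d) : gf2SolveBit A b j = x j := by
  have hlen : ∀ r ∈ (List.ofFn fun i => List.ofFn (augRows A b j i)), r.length = d + 1 := by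
    intro r hr
    obtain ⟨i, rfl⟩ := List.mem_ofFn.1 hr
    simp
  have hne : (List.ofFn fun i => List.ofFn (augRows A b j i)) ≠ [] := by simp
  have key : HasKernel (d + 1) (List.ofFn fun i => List.ofFn (augRows A b j i)) ↔ x j = true := by
    rw [hasKernel_ofFn_iff]
    have t1 : toZ true = 1 := rfl
    have t0 : toZ false = 0 := rfl
    constructor
    · rintro ⟨s, hs0, hev⟩
      -- `s = snoc y c₀`
      set y : Fin d → Bool := fun c => s (Fin.castSucc c) with hy
      set c₀ : Bool := s (Fin.last d) with hc₀
      have hs : s = Fin.snoc y c₀ := by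
        rw [hy, hc₀]
        exact (Fin.snoc_init_self s).symm
      have hrows : ∀ i : Fin m', ∑ c, toZ (A i c) * toZ (y c) + toZ (b i) * toZ c₀ = 0 := by
        intro i
        have h := (sum_toZ_mul_toZ_eq_zero_iff (augRows A b j (Fin.castSucc i)) s).2 (by
          simpa [Bool.and_comm] using hev (Fin.castSucc i))
        rw [hs, augRows, Fin.snoc_castSucc, sum_snoc_toZ] at h
        exact h
      have hpin : toZ (y j) + toZ c₀ = 0 := by
        have h := (sum_toZ_mul_toZ_eq_zero_iff (augRows A b j (Fin.last m')) s).2 (by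
          simpa [Bool.and_comm] using hev (Fin.last m'))
        rw [hs, augRows, Fin.snoc_last, sum_snoc_toZ, sum_toZ_pin, t1, one_mul] at h
        exact h
      cases hcc : c₀
      · -- `c₀ = 0`: `A y = 0`, so `y = 0`, so `s = 0`
        exfalso
        rw [hcc] at hrows
        have hy0 : y = fun _ => false := eq_false_of_fullRank hA fun i => by
          have h := hrows i
          rwa [t0, mul_zero, add_zero] at h
        apply hs0
        rw [hs, hy0, hcc]
        funext i
        refine Fin.lastCases ?_ (fun c => ?_) i <;> simp
      · -- `c₀ = 1`: `y` solves, so `y = x`, and the pin gives `x j = 1`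
        rw [hcc] at hrows hpin
        have hyx : y = x := solves_unique hA (fun i => ?_) hx
        · rw [← hyx]
          rw [t1] at hpin
          cases hyj : y j
          · rw [hyj, t0, zero_add] at hpin
            exact absurd hpin (by decide)
          · rfl
        · have h := hrows i
          rw [t1, mul_one] at h
          have := eq_neg_of_add_eq_zero_left h
          rw [this, ZMod.neg_eq_self_mod_two]
    · intro hxj
      refine ⟨Fin.snoc x true, fun h => ?_, fun i => ?_⟩
      · have := congrFun h (Fin.last d)
        simp at this
      · rw [← sum_toZ_mul_toZ_eq_zero_iff]
        simp_rw [mul_comm (toZ ((Fin.snoc x true : Fin (d + 1) → Bool) _)) _]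
        refine Fin.lastCases ?_ (fun i' => ?_) i
        · rw [augRows, Fin.snoc_last, sum_snoc_toZ, sum_toZ_pin, hxj]
          decide
        · rw [augRows, Fin.snoc_castSucc, sum_snoc_toZ, hx i', t1, mul_one]
          exact CharTwo.add_self_eq_zero _
  unfold gf2SolveBit
  by_cases hxj : x j = true
  · rw [hxj]
    exact (progK_eq_true_iff hne hlen).2 (key.2 hxj)
  · rw [Bool.not_eq_true] at hxj
    rw [hxj]
    by_contra h
    rw [Bool.not_eq_false] at h
    have := key.1 ((progK_eq_true_iff hne hlen).1 h)
    rw [hxj] at this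
    exact Bool.false_ne_true this

/-- **The solver returns the solution of a full-column-rank solvable system.**
[cite: MicciancioPeikert2012, Thm. 3.1 proof (p. 16)] -/
theorem gf2Solve_eq {A : Fin m' → Fin d → Bool} (hA : FullRank (matZ A)) {b : Fin m' → Bool}
    {x : Fin d → Bool} (hx : Solves A b x) : gf2Solve A b = x :=
  funext fun j => gf2SolveBit_eq hA hx j

end Solve

end MP12

end LWE

end Literature.Computability.Cryptography
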